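import Literature.NumberTheory.EllipticCurves.BSDInvariants
import Literature.NumberTheory.EllipticCurves.PAdicHeights

/-!
# `Lines/Rung_mult3_r1_special.lean` — F3 special-case check for rung R5 (`g1-BSD-rank1-R5`)

FLOOR (Castella, Erratum Thm. A′, named fact `castella_thmA'`) is LITERALLY the specialisation
`p₀ = 5` of the graded family `RungMultR1 p₀`; RUNG = `RungMultR1 3`.  Zero `sorry`.
(Defs are verbatim copies of `Lines/Rung_mult3_r1.lean`; kept self-contained so the check does not
depend on the line module being built.)
-/

noncomputable section
open scoped Classical

namespace Summit.BirchSwinnertonDyer.BirchSwinnertonDyer.Cruxes.KatoDivisibility.RungMult3R1.Special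

open WeierstrassCurve

def PPart (W : WeierstrassCurve ℚ) [W.IsElliptic] (p : ℕ) [Fact p.Prime] : Prop :=
  ∃ q : ℚ, W.leadingLCoeff / ((W.realPeriodRat * W.regulator : ℝ) : ℂ) = (q : ℂ) ∧
    padicValRat p q = (padicValNat p W.shaOrder : ℤ) + padicValNat p W.tamagawaProduct -
      2 * padicValNat p W.torsionOrder

def RungMultR1 (p₀ : ℕ) : Prop :=
  ∀ (W : WeierstrassCurve ℚ) [W.IsElliptic] [W.IsGloballyMinimal] (p : ℕ) [Fact p.Prime],
    p₀ ≤ p → W.analyticRank = 1 → W.HasMultiplicativeReductionAtPrime p →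
    W.HasIrreducibleModPGaloisRep p →
    (∃ (q : ℕ) (_ : Fact q.Prime), q ≠ p ∧ W.HasMultiplicativeReductionAtPrime q ∧
      ¬ W.HasSplitMultiplicativeReductionAtPrime q ∧ ¬ p ∣ padicValInt q W.minimalDiscriminantInt) →
    (∀ P : (W.baseChange ℚ_[p]).toAffine.Point, p • P = 0 → P = 0) →
    PPart W p

/-- FLOOR: Castella, Erratum Thm. A′ (`p > 3` ⟺ `5 ≤ p`). [cite: paper:url-e83251f1873d, Thm. A′] -/
def castella_thmA' : Prop :=
  ∀ (W : WeierstrassCurve ℚ) [W.IsElliptic] [W.IsGloballyMinimal] (p : ℕ) [Fact p.Prime],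
    5 ≤ p → W.analyticRank = 1 → W.HasMultiplicativeReductionAtPrime p →
    W.HasIrreducibleModPGaloisRep p →
    (∃ (q : ℕ) (_ : Fact q.Prime), q ≠ p ∧ W.HasMultiplicativeReductionAtPrime q ∧
      ¬ W.HasSplitMultiplicativeReductionAtPrime q ∧ ¬ p ∣ padicValInt q W.minimalDiscriminantInt) →
    (∀ P : (W.baseChange ℚ_[p]).toAffine.Point, p • P = 0 → P = 0) →
    PPart W p

def Rung_mult3_r1 : Prop := RungMultR1 3

/-- F3: `Rung <floor params>` from the floor decl by `simpa`. -/
example (h : castella_thmA') : RungMultR1 5 := by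
  simpa [RungMultR1, castella_thmA'] using h

/-- It is even definitional. -/
example (h : castella_thmA') : RungMultR1 5 := h

/-- RUNG → FLOOR by specialisation of the threshold. -/
example (h : Rung_mult3_r1) : RungMultR1 5 :=
  fun W _ _ p _ hp => h W p (le_trans (by norm_num) hp)

end Summit.BirchSwinnertonDyer.BirchSwinnertonDyer.Cruxes.KatoDivisibility.RungMult3R1.Special
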